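import Summits.HodgeConjecture.FermatCycles.ConditionQObstruction
import Summits.HodgeConjecture.FermatCycles.ShiodaConditionFourfold
import HarnessLib

/-!
# Shioda's stable-generation condition `(Q⁴ₘ)` FAILS at `m = 33` — kernel certificate by an additive obstruction (part B of 3)

HONEST FRAMING: explicit algebraic cycles for specific Hodge classes on Fermat/Delsarte varieties;
residual open instances listed; no claim on general Hodge.

Topic path `Summits/HodgeConjecture/FermatCycles/` of cell `pub-hfermat` (new work, not literature: a kernel certificate of a FALSE entry of the cell's
table `pub-hfermat-enum/P4-TABLE.md` §(Q⁴ₘ)). Framework: `ConditionQObstruction.lean` (`phi`, `pairsB`, `checkFour`, `checkSixRange`,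
`not_conditionQ_four_of_obstruction`) — the printed argument of [Shioda1981FermatType] (Appendix, `m = 25`) with a general additive invariant.

THE CERTIFICATE at `m = 33`: the functional `Φ(s) = Σ_{x ∈ s} c(x)` with `c(11) = -1`, `c(22) = 1` (all other `c(x) = 0`; found by `code/lit/q4/sepfunc.py` as a
vector of the rational null space of the generator matrix — `283` generators: `16` pairs, `146` Hodge `4`-multisets, `121` semi-decomposable Hodge sextuples)
is odd, vanishes on every Hodge `4`-multiset and on every semi-decomposable Hodge sextuple over `ℤ/33` (kernel enumerations below), hence on
`M'_33`; and `Φ(s) = 1` on the Hodge sextuple `s = (1, 4, 16, 22, 25, 31)`. So `s` is not `ξ₁ − ξ₂` with `ξᵢ ∈ M'_33`: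
* part B of 3: the kernel searches `checkSixRange 33 c 8 25` (55575 loop iterations);

PRINT STATUS (lit seat, 2026-08-20). `33 = 3·11`: `(P₃₃)` is false in print ([daSilva2021HodgeFermat], Exp. Results 2 (2021) e22, Prop. 3.4 of the version of record); `(Q⁴₃₃)` is the cell's FALSE entry (P4-TABLE §(Q⁴ₘ), `data/shioda_Q4_m3-100.json`; E3 fails in both grade implementations); HC(X⁴₃₃) itself is reached in the tree only by LEVEL RAISING to `66` (sibling cell pub-hodgefermat, `NotReachThirtyThree`) and is asserted by the unrefereed preprint [Jumagulov2026OddFermatFourfolds] (Thm 1.1; its Thm 1.6 is a field-of-definition obstruction at `33`). This file: Shioda's 1979 framework, even in its stable form `(Q)`, provably does not reach the class `(1,4,16,22,25,31)` of `X⁴₃₃` — kernel theorem; nothing is claimed about the algebraicity of that class.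

References: [Shioda1979HodgeFermat] T. Shioda, Math. Ann. 245 (1979) §4 pp. 183–184 (`M'ₘ`, `(Qⁿₘ)`); [Shioda1981FermatType] T. Shioda,
Math. Ann. 258 (1981), Appendix pp. 78–79; [Shioda1979PJA] T. Shioda, Proc. Japan Acad. 55A (1979) §1; [daSilva2021HodgeFermat] G. da Silva Jr.,
Experimental Results 2 (2021) e22; [Aoki1987] N. Aoki, J. Math. Soc. Japan 39 (1987); [Aoki2000FermatTypeRemarks] N. Aoki, Comment. Math.
Univ. St. Pauli 49 (2000); [Jumagulov2026OddFermatFourfolds] R. Jumagulov, arXiv:2608.18134 (preprint). Cell: P4-TABLE.md, data/shioda_Q4_m3-100.json,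
code/lit/q4/sepfunc.py (this seat).
-/

namespace Summit.HodgeConjecture.FermatCycles.ConditionQObstruction

open Multiset
open Literature.AlgebraicGeometry.HodgeTheory Literature.AlgebraicGeometry.HodgeTheory.FermatCharacter
open Literature.AlgebraicGeometry.Shioda1979 Literature.AlgebraicGeometry.Shioda1982
open Summit.HodgeConjecture.FermatCycles.ShiodaConditionFourfold

/-! ### Level `33` — part B; the functional `c` is written out in every statement (theorem-only files) -/

set_option maxHeartbeats 0 in
/-- `Φ_c` vanishes on the semi-decomposable Hodge sextuples with first representative `a ∈ [8, 33)` (55575 loop iterations). Kernel.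
[cite: Shioda1979HodgeFermat, §4 p. 183 (Mₘ(3)^sd ⊂ M'ₘ)] -/
theorem checkSix_33_8 :
    checkSixRange 33
      ([0, 0, 0, 0, 0, 0, 0, 0, 0, 0, 0, -1, 0, 0, 0, 0, 0, 0, 0, 0, 0, 0, 1, 0, 0, 0, 0, 0, 0, 0, 0, 0, 0] : List ℤ)
      8 25 = true := by
  decide +kernel

end Summit.HodgeConjecture.FermatCycles.ConditionQObstruction
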